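import Summits.QuantumFields.QCD.Theses.WilsonMobilityGap
import Summits.QuantumFields.QCD.Theorems.WilsonMobilityGapMobilityGapStubLightMoment
import Literature.Barriers.QuantumFields.WilsonDeterminantSign

/-!
# Sketch — crux idea `integer-pinch-unitary-point` (crux stmt-QuantumFields-9150, ideator 6, round 2)

First-lemma file (NOT a skeleton: no `stub_*`, no `MobilityGap_of`).  It types

* §1 `twistedWardSumRule` — the exact, configuration-wise lattice Goldstone / Banks–Casher identity
  `ω · Σ_q |A⁻¹(p,q)|² = -Im (A⁻¹ Γ)(p,p)`, `A = D + iωΓ`, for ANY `Γ`-Hermitian `D`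
  (`Γ D Γ = Dᴴ`, `Γ² = 1`, `Γ = Γᴴ`) — PROVED, sorry-free; and its Wilson instance (THE FIRST LEMMA of
  the card, also proved): twisted mass × (row-ℓ² norm of the twisted quark propagator) = local twisted
  condensate.
* §2 `moment_interpolation` (Hölder: `∫X² ≤ (∫X^s)^θ(∫X^q)^{1-θ}` on a probability space) and
  `SecondMomentPoint` / `lightMomentAt_of_secondMomentPoint` — the descent from a volume-uniform
  pointwise lower bound on the SECOND moment (the pion correlator, by
  `IntegerCriticalLine.PionContractionEqNormSq`) plus a uniform integrable `q`-moment bound (`2 < q`)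
  to the core's `s < 1` moment `LightMomentAt … s` with rate `r = 0` — ALL PROVED, sorry-free.
* §3 `ValenceDelocalisationPQ` — the phase-quenched, sea-uniform twin of
  `IntegerCriticalLine.CriticalLineExists` (stmt-9692): the VALENCE integer pinch under the
  `|det D_W(U,x,1)|^{N_f}`-reweighted Wilson measure, for every sea mass `x ∈ [-1, 1]` (statement only).
-/

noncomputable section

open scoped BigOperators Topology ComplexConjugate
open MeasureTheory Filter Set Matrix Complex
open Literature.MathematicalPhysics.QuantumFieldTheory Literature.MathematicalPhysics.QuantumLattice
  Literature.Probability.LatticeModels Literature.Barriers.QuantumFields.WilsonDeterminant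
open Summit.QuantumFields.QCD.Theorems.MobilityGapSketch

namespace Summit.QuantumFields.QCD.Cruxes.MobilityGap.IntegerPinch

/-! ### §1 The twisted Ward sum rule (exact lattice Goldstone identity) -/

/-- **Twisted Ward sum rule (abstract).** For a `Γ`-Hermitian matrix `D` (`Γ D Γ = Dᴴ`, `Γ` a
Hermitian involution) and a real twist `ω ≠ 0`, the twisted operator `A = D + iωΓ` is invertible and
for every index `p`: `ω · Σ_q |A⁻¹(p,q)|² = -Im (A⁻¹ Γ)(p,p)`.
PROVED (sorry-free): `A` is injective (`Γ A = ΓD + iω` with `ΓD` Hermitian, so `Im⟨u, ΓA u⟩ = ω‖u‖²`),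
`X := A⁻¹`, `XΓ - ΓXᴴ = X(ΓAᴴ - AΓ)Xᴴ = (c̄ - c)·XXᴴ = -2iω·XXᴴ`, and the `(p,p)` entry's imaginary part
is the claim. -/
theorem twistedWardSumRule {n : Type*} [Fintype n] [DecidableEq n]
    (D Γ : Matrix n n ℂ) (hΓ : Γ.IsHermitian) (hΓ2 : Γ * Γ = 1) (hD : Γ * D * Γ = Dᴴ)
    (ω : ℝ) (hω : ω ≠ 0) (p : n) :
    ω * ∑ q, ‖(D + ((ω : ℂ) * Complex.I) • Γ)⁻¹ p q‖ ^ 2 =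
      -(((D + ((ω : ℂ) * Complex.I) • Γ)⁻¹ * Γ) p p).im := by
  set c : ℂ := (ω : ℂ) * Complex.I with hc
  set A : Matrix n n ℂ := D + c • Γ with hA
  have hΓh : Γᴴ = Γ := hΓ
  have hstarc : star c = -c := by
    rw [hc, star_mul', Complex.star_def, Complex.conj_ofReal, Complex.conj_I]
    ring
  -- `H = Γ D` is Hermitian
  have hH : (Γ * D).IsHermitian := by
    show (Γ * D)ᴴ = Γ * D
    rw [conjTranspose_mul, hΓh, ← hD, Matrix.mul_assoc, Matrix.mul_assoc, hΓ2, Matrix.mul_one]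
  -- `A` is injective, hence invertible
  have hinj : Function.Injective A.mulVec := by
    intro v w hvw
    have h0 : A *ᵥ (v - w) = 0 := by rw [mulVec_sub, hvw, sub_self]
    set u := v - w with hu
    -- apply Γ: (Γ D) u + c u = 0
    have h1 : (Γ * D) *ᵥ u + c • u = 0 := by
      have := congrArg (fun y => Γ *ᵥ y) h0
      simp only [mulVec_zero] at this
      rw [hA, add_mulVec, smul_mulVec, mulVec_add, mulVec_smul, mulVec_mulVec, mulVec_mulVec,
        hΓ2, one_mulVec] at this
      exact this
    -- pair with `star u`
    have h2 : star u ⬝ᵥ ((Γ * D) *ᵥ u) + c * (star u ⬝ᵥ u) = 0 := by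
      have := congrArg (fun y => star u ⬝ᵥ y) h1
      simp only [dotProduct_add, dotProduct_smul, smul_eq_mul, dotProduct_zero] at this
      exact this
    have hreal : (star u ⬝ᵥ ((Γ * D) *ᵥ u)).im = 0 := by
      simpa only [RCLike.im_to_complex] using hH.im_star_dotProduct_mulVec_self u
    have hnorm : star u ⬝ᵥ u = ((∑ i, ‖u i‖ ^ 2 : ℝ) : ℂ) := by
      rw [dotProduct, Complex.ofReal_sum]
      refine Finset.sum_congr rfl fun i _ => ?_
      rw [Pi.star_apply, Complex.star_def, ← Complex.normSq_eq_norm_sq, ← Complex.mul_conj, mul_comm]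
    set R : ℝ := ∑ i, ‖u i‖ ^ 2 with hR
    have him := congrArg Complex.im h2
    rw [Complex.add_im, hreal, zero_add, hnorm, Complex.zero_im, hc] at him
    have hωR : ω * R = 0 := by
      have e : ((ω : ℂ) * Complex.I * (R : ℂ)).im = ω * R := by
        simp [Complex.mul_im, Complex.mul_re]
      rw [e] at him
      exact him
    have hsum : R = 0 := by
      rcases mul_eq_zero.1 hωR with h | h
      · exact absurd h hω
      · exact h
    have hui : ∀ i, u i = 0 := by
      intro i
      have hle : ‖u i‖ ^ 2 ≤ ∑ j, ‖u j‖ ^ 2 :=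
        Finset.single_le_sum (f := fun j => ‖u j‖ ^ 2) (fun j _ => by positivity) (Finset.mem_univ i)
      rw [hR] at hsum
      rw [hsum] at hle
      have : ‖u i‖ ^ 2 = 0 := le_antisymm hle (by positivity)
      simpa using this
    have : u = 0 := funext hui
    exact sub_eq_zero.1 this
  have hunit : IsUnit A := (Matrix.mulVec_injective_iff_isUnit).1 hinj
  have hdet : IsUnit A.det := (Matrix.isUnit_iff_isUnit_det A).1 hunit
  set X : Matrix n n ℂ := A⁻¹ with hX
  have h1 : X * A = 1 := nonsing_inv_mul A hdet
  have h2 : Aᴴ * Xᴴ = 1 := by rw [← conjTranspose_mul, h1, conjTranspose_one]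
  have hAct : Aᴴ = Γ * D * Γ + (star c) • Γ := by
    rw [hA, conjTranspose_add, conjTranspose_smul, hΓh, hD]
  have hcomm : Γ * Aᴴ - A * Γ = (star c - c) • (1 : Matrix n n ℂ) := by
    rw [hAct, hA, Matrix.mul_add, Matrix.add_mul, Matrix.mul_smul, Matrix.smul_mul, ← Matrix.mul_assoc,
      ← Matrix.mul_assoc, hΓ2, Matrix.one_mul, sub_smul]
    abel
  have e1 : X * (Γ * Aᴴ) * Xᴴ = X * Γ := by
    rw [Matrix.mul_assoc, Matrix.mul_assoc, h2, Matrix.mul_one]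
  have e2 : X * (A * Γ) * Xᴴ = Γ * Xᴴ := by
    rw [← Matrix.mul_assoc, h1, Matrix.one_mul]
  have key : X * Γ - Γ * Xᴴ = (star c - c) • (X * Xᴴ) := by
    rw [← e1, ← e2, ← Matrix.sub_mul, ← Matrix.mul_sub, hcomm, Matrix.mul_smul, Matrix.mul_one,
      Matrix.smul_mul]
  -- the `(p,p)` entry
  have hpp := congrFun (congrFun key p) p
  have hΓX : (Γ * Xᴴ) p p = star ((X * Γ) p p) := by
    rw [← conjTranspose_apply, conjTranspose_mul, hΓh]
  have hXX : (X * Xᴴ) p p = ((∑ q, ‖X p q‖ ^ 2 : ℝ) : ℂ) := by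
    rw [Matrix.mul_apply, Complex.ofReal_sum]
    refine Finset.sum_congr rfl fun q _ => ?_
    rw [conjTranspose_apply, Complex.star_def, ← Complex.normSq_eq_norm_sq, ← Complex.mul_conj]
  rw [Matrix.sub_apply, Matrix.smul_apply, smul_eq_mul, hΓX, hXX, hstarc] at hpp
  -- imaginary parts
  have him := congrArg Complex.im hpp
  simp only [Complex.sub_im, Complex.star_def, Complex.conj_im, Complex.mul_im, Complex.ofReal_re,
    Complex.ofReal_im, mul_zero, add_zero, Complex.neg_re, Complex.neg_im, Complex.sub_re, hc,
    Complex.mul_re, Complex.I_re, Complex.I_im, Complex.ofReal_re, Complex.ofReal_im, mul_one,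
    sub_zero] at him
  -- `him : z.im - -z.im = (-(ω) - ω) * Σ‖X p q‖²`-ish; conclude
  show ω * ∑ q, ‖X p q‖ ^ 2 = -((X * Γ) p p).im
  nlinarith [him]

/-- **First lemma of the card (Wilson instance).** For every SU(3) lattice gauge field `U` on any
four-torus, every real bare mass `x` and twist `ω ≠ 0`, with `A = D_W(U,x,1) + iω Γ₅`
(`Γ₅ = spinorLift gammaFive`; γ₅-hermiticity is the discharged tree fact
`wilsonDirac_gammaFive_hermitian_holds`): for every quark index `p`,
`ω · Σ_q |A⁻¹(p,q)|² = -Im (A⁻¹Γ₅)(p,p)` — twisted mass × charged (row) susceptibility of the twisted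
quark propagator = local twisted condensate, configuration by configuration, on every volume, with any
boundary condition.  Averaged under ANY gauge-field measure it is the exact lattice form of the
Goldstone / Banks–Casher mechanism for the Aoki order parameter `⟨ψ̄ iγ₅ τ³ ψ⟩`. -/
theorem twistedWardSumRule_wilson {L : ℕ} [NeZero L]
    (U : GaugeConfig 4 L (Matrix.specialUnitaryGroup (Fin 3) ℂ)) (x ω : ℝ) (hω : ω ≠ 0)
    (p : TorusSite 4 L × Fin 3 × Fin 4) :
    ω * ∑ q, ‖(wilsonDirac (fundamentalRep (Fin 3)) U x 1 +
        ((ω : ℂ) * Complex.I) • (spinorLift gammaFive :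
          Matrix (TorusSite 4 L × Fin 3 × Fin 4) (TorusSite 4 L × Fin 3 × Fin 4) ℂ))⁻¹ p q‖ ^ 2 =
      -(((wilsonDirac (fundamentalRep (Fin 3)) U x 1 +
        ((ω : ℂ) * Complex.I) • (spinorLift gammaFive :
          Matrix (TorusSite 4 L × Fin 3 × Fin 4) (TorusSite 4 L × Fin 3 × Fin 4) ℂ))⁻¹ *
          (spinorLift gammaFive :
            Matrix (TorusSite 4 L × Fin 3 × Fin 4) (TorusSite 4 L × Fin 3 × Fin 4) ℂ)) p p).im := by
  refine twistedWardSumRule _ _ ?_ spinorLift_gammaFive_mul_self ?_ ω hω p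
  · -- `Γ₅` is Hermitian
    exact conjTranspose_spinorLift_gammaFive
  · exact wilsonDirac_gammaFive_hermitian_holds (fundamentalRep (Fin 3))
      fundamentalRep_mem_unitaryGroup U x 1

/-! ### §2 From second-moment long-range order to the core's `s < 1` light moment -/

/-- **Moment interpolation (Hölder / Lyapunov).** On a probability space, for a non-negative measurable
`X` with `X^q` integrable and exponents `0 < s < 2 < q`:
`∫ X² ≤ (∫ X^s)^{(q-2)/(q-s)} · (∫ X^q)^{(2-s)/(q-s)}`. -/
theorem moment_interpolation {α : Type*} [MeasurableSpace α] {μ : Measure α} [IsProbabilityMeasure μ]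
    {X : α → ℝ} (hX : Measurable X) (hX0 : ∀ a, 0 ≤ X a) {s q : ℝ} (hs : 0 < s) (hs2 : s < 2)
    (hq : 2 < q) (hint : Integrable (fun a => X a ^ q) μ) :
    ∫ a, X a ^ (2 : ℝ) ∂μ ≤
      (∫ a, X a ^ s ∂μ) ^ ((q - 2) / (q - s)) * (∫ a, X a ^ q ∂μ) ^ ((2 - s) / (q - s)) := by
  -- exponents
  set θ : ℝ := (q - 2) / (q - s) with hθ
  have hqs : 0 < q - s := by linarith
  have hθ0 : 0 < θ := div_pos (by linarith) hqs
  have hθ1 : θ < 1 := by rw [hθ, div_lt_one hqs]; linarith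
  have h1θ : 0 < 1 - θ := by linarith
  have hθ' : 1 - θ = (2 - s) / (q - s) := by
    rw [hθ]; field_simp; ring
  -- Hölder conjugate exponents p = 1/θ, p' = 1/(1-θ)
  set p : ℝ := 1 / θ with hp
  set p' : ℝ := 1 / (1 - θ) with hp'
  have hp0 : 0 < p := by rw [hp]; positivity
  have hp'0 : 0 < p' := by rw [hp']; positivity
  have hpq : p.HolderConjugate p' := by
    refine ⟨?_, hp0, hp'0⟩
    rw [hp, hp', one_div, one_div, inv_inv, inv_inv, inv_one]
    ring
  -- the two factors
  set f : α → ℝ := fun a => X a ^ (θ * s) with hf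
  set g : α → ℝ := fun a => X a ^ ((1 - θ) * q) with hg
  have hf0 : ∀ a, 0 ≤ f a := fun a => Real.rpow_nonneg (hX0 a) _
  have hg0 : ∀ a, 0 ≤ g a := fun a => Real.rpow_nonneg (hX0 a) _
  have hfp : ∀ a, f a ^ p = X a ^ s := by
    intro a
    rw [hf, hp]
    simp only
    rw [← Real.rpow_mul (hX0 a)]
    congr 1
    field_simp
  have hgp : ∀ a, g a ^ p' = X a ^ q := by
    intro a
    rw [hg, hp']
    simp only
    rw [← Real.rpow_mul (hX0 a)]
    congr 1
    field_simp
  have hfg : ∀ a, f a * g a = X a ^ (2 : ℝ) := by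
    intro a
    rw [hf, hg]
    simp only
    rw [← Real.rpow_add' (hX0 a)]
    · congr 1
      rw [hθ]; field_simp; ring
    · have : θ * s + (1 - θ) * q = 2 := by rw [hθ]; field_simp; ring
      rw [this]; norm_num
  -- integrability of lower powers on a probability space: `X^t ≤ 1 + X^q` for `0 ≤ t ≤ q`
  have hdom : ∀ {t : ℝ}, 0 ≤ t → t ≤ q → Integrable (fun a => X a ^ t) μ := by
    intro t ht0 htq
    refine Integrable.mono' ((integrable_const (1 : ℝ)).add hint)
      ((hX.pow_const t).aestronglyMeasurable) (Eventually.of_forall fun a => ?_)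
    rw [Real.norm_eq_abs, abs_of_nonneg (Real.rpow_nonneg (hX0 a) _)]
    by_cases hx1 : X a ≤ 1
    · calc X a ^ t ≤ 1 := Real.rpow_le_one (hX0 a) hx1 ht0
        _ ≤ 1 + X a ^ q := le_add_of_nonneg_right (Real.rpow_nonneg (hX0 a) _)
    · push Not at hx1
      calc X a ^ t ≤ X a ^ q := Real.rpow_le_rpow_of_exponent_le hx1.le htq
        _ ≤ 1 + X a ^ q := le_add_of_nonneg_left zero_le_one
  -- MemLp of the factors
  have hθs0 : 0 ≤ θ * s := by positivity
  have hfmeas : AEStronglyMeasurable f μ := (hX.pow_const _).aestronglyMeasurable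
  have hgmeas : AEStronglyMeasurable g μ := (hX.pow_const _).aestronglyMeasurable
  have hfLp : MemLp f (ENNReal.ofReal p) μ := by
    rw [← integrable_norm_rpow_iff hfmeas (by simp [hp0]) ENNReal.ofReal_ne_top]
    rw [ENNReal.toReal_ofReal hp0.le]
    have : (fun a => ‖f a‖ ^ p) = fun a => X a ^ s := by
      funext a; rw [Real.norm_eq_abs, abs_of_nonneg (hf0 a), hfp a]
    rw [this]
    exact hdom hs.le (by linarith)
  have hgLp : MemLp g (ENNReal.ofReal p') μ := by
    rw [← integrable_norm_rpow_iff hgmeas (by simp [hp'0]) ENNReal.ofReal_ne_top]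
    rw [ENNReal.toReal_ofReal hp'0.le]
    have : (fun a => ‖g a‖ ^ p') = fun a => X a ^ q := by
      funext a; rw [Real.norm_eq_abs, abs_of_nonneg (hg0 a), hgp a]
    rw [this]
    exact hint
  have hH := integral_mul_le_Lp_mul_Lq_of_nonneg hpq (Eventually.of_forall hf0)
    (Eventually.of_forall hg0) hfLp hgLp
  -- rewrite Hölder's conclusion
  have e1 : (fun a => f a * g a) = fun a => X a ^ (2 : ℝ) := funext hfg
  have e2 : (fun a => f a ^ p) = fun a => X a ^ s := funext hfp
  have e3 : (fun a => g a ^ p') = fun a => X a ^ q := funext hgp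
  rw [show (∫ a, f a * g a ∂μ) = ∫ a, X a ^ (2 : ℝ) ∂μ from by rw [e1],
    show (∫ a, f a ^ p ∂μ) = ∫ a, X a ^ s ∂μ from by rw [e2],
    show (∫ a, g a ^ p' ∂μ) = ∫ a, X a ^ q ∂μ from by rw [e3]] at hH
  have hp1 : 1 / p = θ := by rw [hp, one_div_one_div]
  have hp'1 : 1 / p' = (2 - s) / (q - s) := by rw [hp', one_div_one_div, hθ']
  rw [hp1, hp'1] at hH
  exact hH

/-- `SecondMomentPoint Nf a β q`: eventually in `k`, at SOME bare mass `x > -1` and flavour `f`, the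
phase-quenched SECOND moment of the propagator entry sum (the charged-pion correlator) is bounded BELOW
pointwise along the time axis, and the `q`-th moment is bounded ABOVE and INTEGRABLE (typing checklist
(ii): without the integrability conjunct the Bochner junk value `0 ≤ C` would satisfy the bound
vacuously), uniformly in all large tori — the Aoki-branch output of the unitary pinch (long-range order
of `E_{|w|}‖G(0,v)‖²`). -/
def SecondMomentPoint (Nf : ℕ) (_a β : ℕ → ℝ) (q : ℝ) : Prop :=
  ∀ᶠ k in atTop, ∃ x : ℝ, -1 < x ∧ ∃ (f : Fin Nf) (c C : ℝ), 0 < c ∧ ∃ S₀ : ℕ,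
    ∀ S : ℕ, S₀ ≤ S → ∀ n : ℕ, n ≤ S →
      c ≤ fm Nf (β k) (fun _ => x) S f (Pi.single 0 (n : ℤ)) 2 ∧
        fm Nf (β k) (fun _ => x) S f (Pi.single 0 (n : ℤ)) q ≤ C ∧
          Integrable (fun U => propSum Nf S (fun _ => x) f (Pi.single 0 (n : ℤ)) U ^ q)
            (qcdLatticeMeasure (2 * S + 1) (β k) (fun _ : Fin Nf => x))

/-- `fm` is non-negative. -/
theorem fm_nonneg' (Nf : ℕ) (β : ℝ) (t : Fin Nf → ℝ) (S : ℕ) (f : Fin Nf)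
    (v : Literature.Probability.LatticeModels.Site 4) (s : ℝ) : 0 ≤ fm Nf β t S f v s := by
  rw [fm_eq_integral]
  exact integral_nonneg fun U => Real.rpow_nonneg (propSum_nonneg Nf S t f v U) _

/-- **Hölder descent.** A pointwise second-moment lower bound with a uniform integrable `q`-moment bound,
`2 < q`, gives the light `s`-moment for every `s ∈ (0,1)` with rate `r = 0`. -/
theorem lightMomentAt_of_secondMomentPoint {Nf : ℕ} {a β : ℕ → ℝ} {q : ℝ} (hq : 2 < q)
    (h : SecondMomentPoint Nf a β q) {s : ℝ} (hs : 0 < s) (hs1 : s < 1) :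
    LightMomentAt Nf a β s := by
  refine ⟨0, ?_⟩
  filter_upwards [h] with k hk
  obtain ⟨x, hx, f, c, C, hc, S₀, hS⟩ := hk
  have hs2 : s < 2 := by linarith
  have hqs : 0 < q - s := by linarith
  set θ : ℝ := (q - 2) / (q - s) with hθ
  set e : ℝ := (2 - s) / (q - s) with he
  have hθ0 : 0 < θ := div_pos (by linarith) hqs
  have he0 : 0 < e := div_pos (by linarith) hqs
  -- `C > 0`, from the instance `S = S₀`, `n = 0`
  have hmain : ∀ S : ℕ, S₀ ≤ S → ∀ n : ℕ, n ≤ S →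
      c ≤ fm Nf (β k) (fun _ => x) S f (Pi.single 0 (n : ℤ)) s ^ θ * C ^ e ∧ 0 < C := by
    intro S hS0 n hn
    obtain ⟨h2, hqC, hint⟩ := hS S hS0 n hn
    haveI := isProbabilityMeasure_qcdLatticeMeasure_all (S := 2 * S + 1) (β k) (fun _ : Fin Nf => x)
    have hI := moment_interpolation (μ := qcdLatticeMeasure (2 * S + 1) (β k) (fun _ : Fin Nf => x))
      (measurable_propSum Nf S (fun _ => x) f (Pi.single 0 (n : ℤ)))
      (propSum_nonneg Nf S (fun _ => x) f (Pi.single 0 (n : ℤ))) hs hs2 hq hint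
    rw [← fm_eq_integral, ← fm_eq_integral, ← fm_eq_integral] at hI
    have hB0 : 0 ≤ fm Nf (β k) (fun _ => x) S f (Pi.single 0 (n : ℤ)) q := fm_nonneg' _ _ _ _ _ _ _
    have hA0 : 0 ≤ fm Nf (β k) (fun _ => x) S f (Pi.single 0 (n : ℤ)) s := fm_nonneg' _ _ _ _ _ _ _
    have hC0 : 0 < C := by
      by_contra hC
      push Not at hC
      have hB : fm Nf (β k) (fun _ => x) S f (Pi.single 0 (n : ℤ)) q = 0 := le_antisymm (hqC.trans hC) hB0
      rw [hB, Real.zero_rpow he0.ne', mul_zero] at hI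
      linarith
    refine ⟨?_, hC0⟩
    calc c ≤ fm Nf (β k) (fun _ => x) S f (Pi.single 0 (n : ℤ)) 2 := h2
      _ ≤ _ := hI
      _ ≤ fm Nf (β k) (fun _ => x) S f (Pi.single 0 (n : ℤ)) s ^ θ * C ^ e := by
        gcongr
  obtain ⟨-, hC0⟩ := hmain S₀ le_rfl 0 (Nat.zero_le _)
  have hCe : 0 < C ^ e := Real.rpow_pos_of_pos hC0 e
  set c' : ℝ := (c / C ^ e) ^ (1 / θ) with hc'
  have hc'0 : 0 < c' := Real.rpow_pos_of_pos (div_pos hc hCe) _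
  refine ⟨x, hx, f, c', hc'0, S₀, fun S hS0 n hn => ?_⟩
  rw [zero_mul, neg_zero, Real.exp_zero, mul_one]
  obtain ⟨hineq, -⟩ := hmain S hS0 n hn
  have hA0 : 0 ≤ fm Nf (β k) (fun _ => x) S f (Pi.single 0 (n : ℤ)) s := fm_nonneg' _ _ _ _ _ _ _
  have hAθ : c / C ^ e ≤ fm Nf (β k) (fun _ => x) S f (Pi.single 0 (n : ℤ)) s ^ θ := by
    rw [div_le_iff₀ hCe]; exact hineq
  calc c' = (c / C ^ e) ^ (1 / θ) := rfl
    _ ≤ (fm Nf (β k) (fun _ => x) S f (Pi.single 0 (n : ℤ)) s ^ θ) ^ (1 / θ) :=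
        Real.rpow_le_rpow (div_pos hc hCe).le hAθ (by positivity)
    _ = fm Nf (β k) (fun _ => x) S f (Pi.single 0 (n : ℤ)) s := by
        rw [one_div, Real.rpow_rpow_inv hA0 hθ0.ne']

/-- Hence (with admissible data and some `s`) the necessary core `LightMomentFree Nf`. -/
theorem lightMomentFree_of_secondMomentPoint {Nf : ℕ} {a β : ℕ → ℝ} {q : ℝ} (hq : 2 < q)
    (ha : ∀ k, 0 < a k) (ha0 : Tendsto a atTop (𝓝 0))
    (hAF : ∃ Λ > (0 : ℝ), Tendsto (fun k => β k - afBeta Nf Λ (a k)) atTop (𝓝 0))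
    (h : SecondMomentPoint Nf a β q) : LightMomentFree Nf :=
  ⟨a, β, ha, ha0, hAF, 1 / 2, by norm_num, by norm_num,
    lightMomentAt_of_secondMomentPoint hq h (by norm_num) (by norm_num)⟩

/-! ### §3 The phase-quenched valence pinch (sea-uniform twin of `CriticalLineExists`) -/

local notation "𝔾₃" => Matrix.specialUnitaryGroup (Fin 3) ℂ

/-- The phase-quenched fractional moment of the VALENCE resolvent entry of `Γ₅ D_W(U, m₀, 1)` at
complex energy `E + iη`, between `0` and `v`, under the Wilson measure at `β` on the torus of side
`2S+1` reweighted by `|det D_W(U, x, 1)|^{Nf}` (sea mass `x`, degenerate tuple). -/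
def valenceFM (Nf : ℕ) (β x m₀ E η s : ℝ) (S : ℕ) (v : Fin 4 → ℤ) (a b : Fin 3) (α γ : Fin 4) : ℝ :=
  (∫ U : GaugeConfig 4 (2 * S + 1) 𝔾₃,
      ‖fermionDet (wilsonDirac (fundamentalRep (Fin 3)) U x 1)‖ ^ Nf *
        ‖(hermitianWilsonDirac (fundamentalRep (Fin 3)) U m₀ 1 -
            ((E : ℂ) + (η : ℂ) * Complex.I) • (1 : Matrix (TorusSite 4 (2 * S + 1) × Fin 3 × Fin 4)
              (TorusSite 4 (2 * S + 1) × Fin 3 × Fin 4) ℂ))⁻¹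
          ((0 : TorusSite 4 (2 * S + 1)), a, α) (Torus.proj (2 * S + 1) v, b, γ)‖ ^ s
      ∂(wilsonMeasure (d := 4) (L := 2 * S + 1) (fundamentalRep (Fin 3)) β)) /
    (∫ U : GaugeConfig 4 (2 * S + 1) 𝔾₃,
      ‖fermionDet (wilsonDirac (fundamentalRep (Fin 3)) U x 1)‖ ^ Nf
      ∂(wilsonMeasure (d := 4) (L := 2 * S + 1) (fundamentalRep (Fin 3)) β))

/-- **`ValenceDelocalisationPQ Nf`** — the phase-quenched valence integer pinch: at every weak
coupling and for EVERY sea mass `x ∈ [-1, 1]`, no Aizenman–Molchanov bound holds uniformly across the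
valence masses `m₀ ∈ [-1, 1]` under the `|det D_W(x)|^{Nf}`-reweighted measure (the second Chern
number of the Fermi projection of `Γ₅D_W(m₀)` is `0` on `m₀ > 0` by `TrivialPlateauGap` and `≠ 0` in
the first topological pocket, and is constant on mobility gaps of ONE fixed ergodic measure — so the
valence spectrum at `0` delocalises at some `m₀*(x, β)`, WHATEVER the Aoki / Sharpe–Singleton scenario).
`Nf = 0` is `IntegerCriticalLine.CriticalLineExists` verbatim up to the sea-uniformity. -/
def ValenceDelocalisationPQ (Nf : ℕ) : Prop :=
  ∃ β₁ : ℝ, ∀ β : ℝ, β₁ ≤ β → ∀ x : ℝ, -1 ≤ x → x ≤ 1 →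
    ¬ ∃ s E₀ C c : ℝ, 0 < s ∧ s < 1 ∧ 0 < E₀ ∧ 0 < c ∧ ∀ m₀ : ℝ, -1 ≤ m₀ → m₀ ≤ 1 →
      ∀ (S : ℕ) (E η : ℝ), |E| ≤ E₀ → 0 < η → ∀ v : Fin 4 → ℤ, (∀ i, |v i| ≤ S) →
        ∀ (a b : Fin 3) (α γ : Fin 4),
          valenceFM Nf β x m₀ E η s S v a b α γ ≤ C * Real.exp (-(c * ∑ i, |(v i : ℝ)|))

end Summit.QuantumFields.QCD.Cruxes.MobilityGap.IntegerPinch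

end
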